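import Mathlib
import HarnessLib
import Literature.Analysis.Calculus.JacobiFormula

/-!
# Jacobi: the third mixed derivative of `log det` (helper A3 for stub `MarkedCouplingDominance`,
line `coupling-cubic-response`, crux stmt-QuantumFields-9365)

Matrix calculus, independent of any physics.  For a real square matrix `A` with `det A ≠ 0` and
arbitrary "insertions" `Q₀, Q₂, Q₃`, with `C = A⁻¹`,

  `∂_{t₀} ∂_{t₂} ∂_{t₃} log det (A + t₀ Q₀ + t₂ Q₂ + t₃ Q₃) |_{t = 0}
      = tr (C Q₀ C Q₂ C Q₃) + tr (C Q₀ C Q₃ C Q₂)`                    (`deriv3_log_det`)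

(the derivatives are Lean's nested one-variable `deriv`s at `0`; `Real.log x = Real.log |x|`, so no
sign condition on `det A` is needed), and for `A` positive definite and `Q₀, Q₂, Q₃` symmetric the
two traces agree, giving the registered helper stub

  `∂³ log det (A + Σ tᵢ Qᵢ) |₀ = 2 tr (A⁻¹ Q₀ A⁻¹ Q₂ A⁻¹ Q₃)`          (`LogDetCubicResponse`).

Route.  `∂_{t₃} log det M(t₃)|₀ = tr (M⁻¹ Q₃)` is Jacobi's formula (tree:
`Literature.Analysis.Calculus.hasDerivAt_det_eq_det_mul_trace`), valid at every `M` with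
`det M ≠ 0`; since a derivative only depends on the germ of the function
(`Filter.EventuallyEq.deriv_eq`) and `det (B + t Q) ≠ 0` for `t` near `0` whenever `det B ≠ 0`,
the middle and outer `deriv`s are derivatives of the closed forms `t ↦ tr ((B + t Q)⁻¹ Q₃)` and
`t ↦ -tr ((A + t Q₀)⁻¹ Q₂ (A + t Q₀)⁻¹ Q₃)`, computed from
`d/dt (B + t Q)⁻¹ |₀ = -B⁻¹ Q B⁻¹` (Mathlib's `hasFDerivAt_ringInverse` in the `L∞` operator normed
algebra `Matrix.Norms.Operator`, whose topology is the product one) and the product rule; the two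
resulting traces are identified by cyclicity (`Matrix.trace_mul_comm`) and, in the symmetric case,
by `tr Xᵀ = tr X`.  Theorems only, no named facts.
-/

noncomputable section

namespace Summit.QuantumFields.YangMills.Theorems.FemtoCurvatureSkewness

open Filter Topology
open scoped Matrix
open Literature.Analysis.Calculus (hasDerivAt_add_smul_matrix hasDerivAt_det_eq_det_mul_trace)

namespace LogDet

variable {ι : Type*} [Fintype ι] [DecidableEq ι]

/-! ### First derivative: Jacobi's formula along an affine line of matrices -/

/-- Jacobi's formula along the affine line `s ↦ M + s Q` at `s = 0`:
`d/ds det (M + s Q)|₀ = det M · tr (M⁻¹ Q)` (for invertible `M`). -/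
theorem hasDerivAt_det_add_smul (M Q : Matrix ι ι ℝ) (hM : M.det ≠ 0) :
    HasDerivAt (fun s : ℝ => (M + s • Q).det) (M.det * (M⁻¹ * Q).trace) 0 := by
  have hA : HasDerivAt (fun s : ℝ => ((M + s • Q : Matrix ι ι ℝ) : ι → ι → ℝ))
      (Q : ι → ι → ℝ) 0 :=
    hasDerivAt_add_smul_matrix _ _ 0
  have h0 : Matrix.of ((fun s : ℝ => ((M + s • Q : Matrix ι ι ℝ) : ι → ι → ℝ)) 0) = M := by
    change M + (0 : ℝ) • Q = M
    rw [zero_smul, add_zero]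
  have h := hasDerivAt_det_eq_det_mul_trace hA (by rw [h0]; exact isUnit_iff_ne_zero.2 hM)
  rw [h0] at h
  exact h

/-- `d/ds log det (M + s Q)|₀ = tr (M⁻¹ Q)` whenever `det M ≠ 0` (no sign condition:
`Real.log x = Real.log |x|`). -/
theorem hasDerivAt_log_det_add_smul (M Q : Matrix ι ι ℝ) (hM : M.det ≠ 0) :
    HasDerivAt (fun s : ℝ => Real.log ((M + s • Q).det)) ((M⁻¹ * Q).trace) 0 := by
  have h := (hasDerivAt_det_add_smul M Q hM).log (by simpa using hM)
  refine h.congr_deriv ?_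
  simp only [zero_smul, add_zero]
  field_simp

/-- Closed form of the innermost derivative: `deriv (s ↦ log det (M + s Q)) 0 = tr (M⁻¹ Q)`. -/
theorem deriv_log_det_add_smul (M Q : Matrix ι ι ℝ) (hM : M.det ≠ 0) :
    deriv (fun s : ℝ => Real.log ((M + s • Q).det)) 0 = (M⁻¹ * Q).trace :=
  (hasDerivAt_log_det_add_smul M Q hM).deriv

/-- Invertibility persists along the line: `det (B + t Q) ≠ 0` for `t` near `0` if `det B ≠ 0`. -/
theorem eventually_det_add_smul_ne_zero (B Q : Matrix ι ι ℝ) (hB : B.det ≠ 0) :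
    ∀ᶠ t : ℝ in 𝓝 0, (B + t • Q).det ≠ 0 := by
  have hc : Continuous fun t : ℝ => (B + t • Q).det :=
    (continuous_const.add (continuous_id.smul continuous_const)).matrix_det
  exact hc.continuousAt.eventually_ne (by simpa using hB)

/-! ### Derivative of the inverse along an affine line, and of traces of products -/

omit [DecidableEq ι] in
/-- The affine line `t ↦ B + t Q` has derivative `Q` (matrix-valued, product topology). -/
theorem hasDerivAt_add_smul (B Q : Matrix ι ι ℝ) (t : ℝ) :
    HasDerivAt (fun s : ℝ => B + s • Q) Q t :=
  hasDerivAt_add_smul_matrix (B : ι → ι → ℝ) (Q : ι → ι → ℝ) t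

/-- `d/dt (B + t Q)⁻¹ |₀ = -B⁻¹ Q B⁻¹` for invertible `B` (chain rule with Mathlib's derivative of
`Ring.inverse`, taken in the `L∞` operator normed algebra structure on matrices). -/
theorem hasDerivAt_inv_add_smul (B Q : Matrix ι ι ℝ) (hB : B.det ≠ 0) :
    HasDerivAt (fun t : ℝ => (B + t • Q)⁻¹) (-(B⁻¹ * Q * B⁻¹)) 0 := by
  obtain ⟨u, hu⟩ : IsUnit B := (Matrix.isUnit_iff_isUnit_det B).2 (isUnit_iff_ne_zero.2 hB)
  have hinv : ((u⁻¹ : (Matrix ι ι ℝ)ˣ) : Matrix ι ι ℝ) = B⁻¹ := by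
    rw [Matrix.coe_units_inv, hu]
  have hfun : (fun t : ℝ => (B + t • Q)⁻¹) = Ring.inverse ∘ fun t : ℝ => B + t • Q := by
    funext t
    simp only [Function.comp_apply, Matrix.nonsing_inv_eq_ringInverse]
  rw [hfun]
  open scoped Matrix.Norms.Operator in
  (have h1 := hasFDerivAt_ringInverse (𝕜 := ℝ) u
   rw [hu] at h1
   have h3 := h1.comp_hasDerivAt_of_eq (0 : ℝ) (hasDerivAt_add_smul B Q 0) (by simp)
   refine h3.congr_deriv ?_
   simp [hinv])

omit [DecidableEq ι] in
/-- Passing to the trace: `(tr X)' = tr X'`. -/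
theorem hasDerivAt_trace {X : ℝ → Matrix ι ι ℝ} {X' : Matrix ι ι ℝ} {t : ℝ}
    (h : HasDerivAt X X' t) : HasDerivAt (fun s => (X s).trace) X'.trace t := by
  have h' : ∀ i, HasDerivAt (fun s => X s i i) (X' i i) t := fun i =>
    hasDerivAt_pi.1 (hasDerivAt_pi.1 h i) i
  simpa [Matrix.trace, Matrix.diag] using HasDerivAt.fun_sum (u := Finset.univ) fun i _ => h' i

/-- `d/dt tr ((B + t Q)⁻¹ P) |₀ = -tr (B⁻¹ Q B⁻¹ P)`. -/
theorem hasDerivAt_trace_inv_mul (B Q P : Matrix ι ι ℝ) (hB : B.det ≠ 0) :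
    HasDerivAt (fun t : ℝ => ((B + t • Q)⁻¹ * P).trace) (-(B⁻¹ * Q * B⁻¹ * P).trace) 0 := by
  have h : HasDerivAt (fun t : ℝ => (B + t • Q)⁻¹ * P) (-(B⁻¹ * Q * B⁻¹) * P) 0 := by
    open scoped Matrix.Norms.Operator in
    exact (hasDerivAt_inv_add_smul B Q hB).mul_const P
  refine (hasDerivAt_trace h).congr_deriv ?_
  rw [Matrix.neg_mul, Matrix.trace_neg]

/-- `d/dt tr ((B + t Q)⁻¹ P (B + t Q)⁻¹ R) |₀ = -(tr (B⁻¹ Q B⁻¹ P B⁻¹ R) + tr (B⁻¹ P B⁻¹ Q B⁻¹ R))`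
(product rule). -/
theorem hasDerivAt_trace_inv_mul_inv_mul (B Q P R : Matrix ι ι ℝ) (hB : B.det ≠ 0) :
    HasDerivAt (fun t : ℝ => ((B + t • Q)⁻¹ * P * (B + t • Q)⁻¹ * R).trace)
      (-((B⁻¹ * Q * B⁻¹ * P * B⁻¹ * R).trace + (B⁻¹ * P * B⁻¹ * Q * B⁻¹ * R).trace)) 0 := by
  have hN := hasDerivAt_inv_add_smul B Q hB
  have h : HasDerivAt (fun t : ℝ => (B + t • Q)⁻¹ * P * (B + t • Q)⁻¹ * R)
      ((-(B⁻¹ * Q * B⁻¹) * P * (B + (0 : ℝ) • Q)⁻¹ + (B + (0 : ℝ) • Q)⁻¹ * P * -(B⁻¹ * Q * B⁻¹))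
        * R) 0 := by
    open scoped Matrix.Norms.Operator in
    exact ((hN.mul_const P).fun_mul hN).mul_const R
  refine (hasDerivAt_trace h).congr_deriv ?_
  simp only [zero_smul, add_zero]
  rw [← Matrix.trace_add, ← Matrix.trace_neg]
  congr 1
  noncomm_ring

/-! ### Second and third mixed derivatives of `log det` -/

/-- **Second mixed derivative**: `∂_{t₂} ∂_{t₃} log det (B + t₂ Q₂ + t₃ Q₃)|₀ = -tr (B⁻¹ Q₂ B⁻¹ Q₃)`
for `det B ≠ 0`. -/
theorem deriv2_log_det (B Q₂ Q₃ : Matrix ι ι ℝ) (hB : B.det ≠ 0) :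
    deriv (fun t₂ : ℝ => deriv (fun t₃ : ℝ => Real.log ((B + t₂ • Q₂ + t₃ • Q₃).det)) 0) 0
      = -(B⁻¹ * Q₂ * B⁻¹ * Q₃).trace := by
  have hev : (fun t₂ : ℝ => deriv (fun t₃ : ℝ => Real.log ((B + t₂ • Q₂ + t₃ • Q₃).det)) 0)
      =ᶠ[𝓝 0] fun t₂ => ((B + t₂ • Q₂)⁻¹ * Q₃).trace := by
    filter_upwards [eventually_det_add_smul_ne_zero B Q₂ hB] with t₂ ht₂
    exact deriv_log_det_add_smul (B + t₂ • Q₂) Q₃ ht₂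
  rw [hev.deriv_eq]
  exact (hasDerivAt_trace_inv_mul B Q₂ Q₃ hB).deriv

/-- **Third mixed derivative of `log det` (general form)**: for `det A ≠ 0` and `C = A⁻¹`,
`∂_{t₀} ∂_{t₂} ∂_{t₃} log det (A + t₀ Q₀ + t₂ Q₂ + t₃ Q₃)|₀ = tr (C Q₀ C Q₂ C Q₃) + tr (C Q₀ C Q₃ C Q₂)`
(no symmetry or sign assumptions). -/
theorem deriv3_log_det (A Q₀ Q₂ Q₃ : Matrix ι ι ℝ) (hA : A.det ≠ 0) :
    deriv (fun t₀ : ℝ => deriv (fun t₂ : ℝ => deriv (fun t₃ : ℝ =>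
        Real.log ((A + t₀ • Q₀ + t₂ • Q₂ + t₃ • Q₃).det)) 0) 0) 0
      = (A⁻¹ * Q₀ * A⁻¹ * Q₂ * A⁻¹ * Q₃).trace + (A⁻¹ * Q₀ * A⁻¹ * Q₃ * A⁻¹ * Q₂).trace := by
  have hev : (fun t₀ : ℝ => deriv (fun t₂ : ℝ => deriv (fun t₃ : ℝ =>
        Real.log ((A + t₀ • Q₀ + t₂ • Q₂ + t₃ • Q₃).det)) 0) 0)
      =ᶠ[𝓝 0] fun t₀ => -((A + t₀ • Q₀)⁻¹ * Q₂ * (A + t₀ • Q₀)⁻¹ * Q₃).trace := by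
    filter_upwards [eventually_det_add_smul_ne_zero A Q₀ hA] with t₀ ht₀
    exact deriv2_log_det (A + t₀ • Q₀) Q₂ Q₃ ht₀
  rw [hev.deriv_eq, (hasDerivAt_trace_inv_mul_inv_mul A Q₀ Q₂ Q₃ hA).fun_neg.deriv, neg_neg]
  congr 1
  calc (A⁻¹ * Q₂ * A⁻¹ * Q₀ * A⁻¹ * Q₃).trace
      = ((A⁻¹ * Q₂) * (A⁻¹ * Q₀ * A⁻¹ * Q₃)).trace := by simp only [Matrix.mul_assoc]
    _ = ((A⁻¹ * Q₀ * A⁻¹ * Q₃) * (A⁻¹ * Q₂)).trace := Matrix.trace_mul_comm _ _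
    _ = (A⁻¹ * Q₀ * A⁻¹ * Q₃ * A⁻¹ * Q₂).trace := by simp only [Matrix.mul_assoc]

omit [DecidableEq ι] in
/-- In the symmetric case the two traces of `deriv3_log_det` coincide:
`tr (C Q₀ C Q₃ C Q₂) = tr (C Q₀ C Q₂ C Q₃)` for symmetric `C, Q₀, Q₂, Q₃` (transpose, then
cyclicity). -/
theorem trace_six_symm (C Q₀ Q₂ Q₃ : Matrix ι ι ℝ) (hC : C.IsSymm) (h₀ : Q₀.IsSymm)
    (h₂ : Q₂.IsSymm) (h₃ : Q₃.IsSymm) :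
    (C * Q₀ * C * Q₃ * C * Q₂).trace = (C * Q₀ * C * Q₂ * C * Q₃).trace := by
  calc (C * Q₀ * C * Q₃ * C * Q₂).trace
      = ((C * Q₀ * C * Q₃ * C * Q₂)ᵀ).trace := (Matrix.trace_transpose _).symm
    _ = ((Q₂ * C * Q₃) * (C * Q₀ * C)).trace := by
        simp only [Matrix.transpose_mul, hC.eq, h₀.eq, h₂.eq, h₃.eq, Matrix.mul_assoc]
    _ = ((C * Q₀ * C) * (Q₂ * C * Q₃)).trace := Matrix.trace_mul_comm _ _
    _ = (C * Q₀ * C * Q₂ * C * Q₃).trace := by simp only [Matrix.mul_assoc]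

end LogDet

/-- **Helper A3 (registered stub `LogDetCubicResponse`), the one-loop sign carrier**: for a
positive-definite real matrix `A` and symmetric insertions `Q₀, Q₂, Q₃`,
`∂_{t₀} ∂_{t₂} ∂_{t₃} log det (A + t₀ Q₀ + t₂ Q₂ + t₃ Q₃)|_{t = 0} = 2 tr (A⁻¹ Q₀ A⁻¹ Q₂ A⁻¹ Q₃)`
(Jacobi's formula three times; `LogDet.deriv3_log_det` plus symmetry). -/
theorem LogDetCubicResponse :
    ∀ (m : ℕ) (A Q₀ Q₂ Q₃ : Matrix (Fin m) (Fin m) ℝ),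
      Matrix.PosDef A → Matrix.IsSymm Q₀ → Matrix.IsSymm Q₂ → Matrix.IsSymm Q₃ →
        deriv (fun t₀ : ℝ => deriv (fun t₂ : ℝ => deriv (fun t₃ : ℝ =>
            Real.log (Matrix.det (A + t₀ • Q₀ + t₂ • Q₂ + t₃ • Q₃))) 0) 0) 0 =
          2 * Matrix.trace (A⁻¹ * Q₀ * A⁻¹ * Q₂ * A⁻¹ * Q₃) := by
  intro m A Q₀ Q₂ Q₃ hA h₀ h₂ h₃
  have hAs : A.IsSymm := Matrix.isHermitian_iff_isSymm.1 hA.isHermitian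
  have hC : (A⁻¹).IsSymm := by
    change A⁻¹ᵀ = A⁻¹
    rw [Matrix.transpose_nonsing_inv, hAs.eq]
  rw [LogDet.deriv3_log_det A Q₀ Q₂ Q₃ hA.det_pos.ne',
    LogDet.trace_six_symm A⁻¹ Q₀ Q₂ Q₃ hC h₀ h₂ h₃, two_mul]

end Summit.QuantumFields.YangMills.Theorems.FemtoCurvatureSkewness

end
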